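import Literature.AlgebraicGeometry.Motives.AbelianVarietyFrobeniusTwistVariety
import Literature.AlgebraicGeometry.GroupSchemes.GroupSchemeKernelBaseChange
import HarnessLib

/-!
# «FROB-KILL»: when a homomorphism followed by the relative Frobenius of its target is trivial

Topic `Literature/AlgebraicGeometry/GroupSchemes`; namespace `Literature.AlgebraicGeometry.GroupSchemes.FrobKill`.  THEOREMS ONLY (no
definition, no named fact, no instance, no notation, no `sorry`).  Cell `hodgecm-mathlib` (D-0151), FLOOR 0, P6 «MOD programme», organ
**(K-c3) «FROB-KILL»** dealt by desk F0P6c-plan (g2) (2026-09-01T15:45:46Z) as the morphism-level engine of the DICT letters (c3b)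
`frob_quot_of_isEtale` («(Ā∕H)∕ker F = Ā∕𝒢[ϖ]» in «kills» form) and (c3c) `frob_frob_of_forall_not_isEtale`; `--supports stmt-HodgeConjecture-24832`.
HC_CM is proved only modulo the printed citations until rung 0 closes; this file is generic and changes no count.

CURRENCY (★ `Motives/AbelianVarietyFrobeniusTwistVariety`, B-p12): `k` a field of exponential characteristic `p`, `q = pⁿ`; for a
`k`-scheme `X` (`SchemeOver k = Over (Spec k)`) the Frobenius twist `X^{(q)} = frobeniusTwistOver p n X = (Over.pullback (Spec Frobⁿ)).obj X`
and the relative (`k`-linear) `q`-Frobenius `F_{X∕k} = relFrobeniusOver p n X : X ⟶ X^{(q)}`, natural in `X` (`relFrobeniusOver_comp_map`: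
`F_X ≫ f^{(q)} = f ≫ F_Y`).  For a `k`-GROUP scheme `G` the twist carries Mathlib's transported group structure `Functor.grpObjObj`
(`open scoped CategoryTheory.Obj`), kernels are ★ `GroupSchemeKernel.ker ∕ kerι ∕ kerLift` and commute with base change
(★ `GroupSchemeKernel.baseChangeIso`).

THE PRINT.  [SGA3I] Exp. VII_A (P. Gabriel) §4.1: the relative Frobenius `F_{G∕S} : G → G^{(p)}` of an `S`-group scheme is a
homomorphism, functorial in `G` and compatible with base change; [GortzWedhorn2020] Def.∕Rem. 4.24 and §(4.7) (Frobenius twist as a base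
change, functoriality).  The two «kill» statements below are elementary consequences used in [Liu2021, App. D, proof of Prop. D.8 (3)]
(ordinary: the quotient by the étale line followed by Frobenius kills the whole `𝔴`-torsion; supersingular: `𝒜[𝔴] ⊆ ker F²`).

WHAT IS HERE (`G G′ : SchemeOver k` group schemes, `φ : G ⟶ G′` any `k`-morphism — being a homomorphism is never used —,
`F = relFrobeniusOver p n`).
* §1 `one_comp_relFrobeniusOver`, `mul_comp_relFrobeniusOver`, **`isMonHom_relFrobeniusOver`** — `F_{G∕k}` is a HOMOMORPHISM for ANY `k`-group
  scheme `G` (★ had it for abelian varieties, `AbelianVariety.relFrobenius`, and over finite base fields, `RelFrobenius.isMonHom_relFrobenius`).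
* §2 **`relFrobeniusOver_frobeniusTwistOver`** — Frobenius commutes with the Frobenius base change: `F_{X^{(q)}∕k} = (F_{X∕k})^{(q)}`.
* §3 (ét) **`comp_relFrobeniusOver_eq_one_of_epi_mul`**: if `a, b : T ⟶ G` with `a * b` an EPIMORPHISM, `a ≫ F_G = 1` and `b ≫ φ = 1`, then
  `φ ≫ F_{G′} = 1`; tensor form **`comp_relFrobeniusOver_eq_one_of_epi_tensorHom_mul`** (`(j ⊗ c) ≫ μ` epi, `j ≫ F_G = 1`, `c ≫ φ = 1`) —
  the (c3b) engine: `G = 𝒜_x̄[𝔴] = G⁰·H` with `H` the étale line killed by the quotient map and `G⁰ ⊆ ker F`.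
* §4 (ss) **`comp_relFrobeniusOver_eq_one_of_kerι_comp_eq_one`**: if `F_G ≫ F_{G^{(q)}} = 1` («`F² = 0` on `G`») and `φ` kills `ker F_G`
  (`kerι F_G ≫ φ = 1`), then `φ ≫ F_{G′} = 1` — the (c3c) engine; proof: `F_G` factors through `ker F_{G^{(q)}} = ker (F_G)^{(q)} ≅ (ker F_G)^{(q)}`
  (§2 + kernel base change) and `φ^{(q)}` kills `(ker F_G)^{(q)}`.
* §5 (ED. 2) the ITERATE bridge: `absFrobeniusOver_comp_absFrobeniusOver` (`F^{abs}_{pⁿ} ≫ F^{abs}_{pⁿ} = F^{abs}_{p^{2n}}`),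
  `one_left_comp_twistFst`, **`comp_relFrobeniusOver_frobeniusTwistOver_eq_one_iff`** (`F_G ≫ F_{G^{(q)}} = 1 ↔ relFrobeniusOver p (n+n) G = 1`,
  `maxHeartbeats 800000` for the doubly transported group structure) and **`comp_relFrobeniusOver_eq_one_of_relFrobeniusOver_two_eq_one`**
  (the (c3c) engine with the hypothesis `relFrobeniusOver p (n+n) G = 1` exactly as ★ `InfinitesimalKilledByFrobeniusPower` delivers it at `t = 2f`).
-/

set_option autoImplicit false

noncomputable section

-- `((Over.pullback f).obj X).left = pullback X.hom f`, `(𝟙_ (Over S)).left = S` and the transported `η ∕ μ` on a base change are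
-- definitional only above `instances` transparency (as in ★ `AbelianVarietyFrobeniusTwistVariety` ∕ `RelativeFrobeniusOverBase`).
set_option backward.isDefEq.respectTransparency false

universe u

open CategoryTheory CategoryTheory.Limits AlgebraicGeometry MonoidalCategory CartesianMonoidalCategory
open scoped MonObj Obj

namespace Literature.AlgebraicGeometry.GroupSchemes.FrobKill

open Literature.AlgebraicGeometry.Motives Literature.AlgebraicGeometry.GroupSchemes.GroupSchemeKernel

variable {k : Type u} [Field k] (p : ℕ) [ExpChar k p] (n : ℕ)

/-! ## §1 `F_{G∕k}` is a homomorphism for every `k`-group scheme `G` -/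

section Hom

variable (G : SchemeOver k) [GrpObj G]

/-- **`F_{G∕k}` respects the units**: `e_G ≫ F_{G∕k} = e_{G^{(q)}}`, the unit of `G^{(q)}` being the base change of that of `G` (compare
first projections: both are `Spec Frobⁿ ≫ e_G`).  Same proof as ★ `AbelianVariety.one_comp_relFrobeniusOver`, for ANY `k`-group scheme.
[cite: SGA3I, VII_A 4.1] -/
theorem one_comp_relFrobeniusOver :
    η[G] ≫ relFrobeniusOver p n G = (η : 𝟙_ (SchemeOver k) ⟶ frobeniusTwistOver p n G) := by
  change _ = Functor.LaxMonoidal.ε (Over.pullback (frobSpec k p n)) ≫ (Over.pullback (frobSpec k p n)).map η[G]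
  apply frobeniusTwistOver_hom_ext
  rw [comp_relFrobeniusOver_left_comp_fst, Over.comp_left, Category.assoc, pullback_map_left_comp_twistFst,
    ε_left_comp_twistFst_assoc, absFrobeniusOver_tensorUnit]

/-- **`F_{G∕k}` respects the group laws**: `m_G ≫ F_{G∕k} = (F × F) ≫ m_{G^{(q)}}` (compare first projections: both are `F^{abs}_{G × G} ≫ m_G`).
[cite: SGA3I, VII_A 4.1] -/
theorem mul_comp_relFrobeniusOver :
    μ[G] ≫ relFrobeniusOver p n G =
      (relFrobeniusOver p n G ⊗ₘ relFrobeniusOver p n G) ≫ (μ : _ ⟶ frobeniusTwistOver p n G) := by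
  change _ = _ ≫ Functor.LaxMonoidal.μ (Over.pullback (frobSpec k p n)) G G ≫ (Over.pullback (frobSpec k p n)).map μ[G]
  apply frobeniusTwistOver_hom_ext
  rw [comp_relFrobeniusOver_left_comp_fst, Over.comp_left, Over.comp_left, Category.assoc, Category.assoc,
    pullback_map_left_comp_twistFst, tensorHom_μ_left_comp_twistFst_assoc]

/-- **The relative `q`-Frobenius `F_{G∕k} : G → G^{(q)}` is a HOMOMORPHISM of `k`-group schemes** for every group object `G` of
`SchemeOver k` (Mathlib's transported group structure on the base change `G^{(q)}`; stated as a theorem — use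
`haveI := isMonHom_relFrobeniusOver p n G`). [cite: SGA3I, VII_A 4.1] [cite: GortzWedhorn2020, Def. 4.24 and Section (4.7)] -/
theorem isMonHom_relFrobeniusOver : IsMonHom (relFrobeniusOver p n G) where
  one_hom := one_comp_relFrobeniusOver p n G
  mul_hom := mul_comp_relFrobeniusOver p n G

end Hom

/-! ## §2 Frobenius commutes with the Frobenius base change: `F_{X^{(q)}∕k} = (F_{X∕k})^{(q)}` -/

/-- **`F_{X^{(q)}∕k} = (F_{X∕k})^{(q)}`**: the relative Frobenius of the twist `X^{(q)}` (a `k`-scheme through the second projection) is the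
base change of the relative Frobenius of `X` — both are `k`-morphisms `X^{(q)} ⟶ (X^{(q)})^{(q)}` whose two projections are the absolute
Frobenius of `X^{(q)}` followed by `pr_X`, resp. the structure map (naturality of the absolute Frobenius ★ `powEndo_comp`).
[cite: SGA3I, VII_A 4.1] [cite: GortzWedhorn2020, Section (4.7)] -/
theorem relFrobeniusOver_frobeniusTwistOver (X : SchemeOver k) :
    relFrobeniusOver p n (frobeniusTwistOver p n X) = (Over.pullback (frobSpec k p n)).map (relFrobeniusOver p n X) := by
  apply frobeniusTwistOver_hom_ext
  rw [relFrobeniusOver_left_comp_fst, pullback_map_left_comp_twistFst]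
  -- both sides are maps `X^{(q)} → X^{(q)} = X ×_{Spec k} Spec k`; compare the two projections
  apply twist_hom_ext p n
  · rw [Category.assoc, relFrobeniusOver_left_comp_fst]
    exact powEndo_comp (p ^ n) (expChar_pow_pos k p n).ne' (add_pow_expChar_pow_sections p n (frobeniusTwistOver p n X))
      (twistFst p n X) (add_pow_expChar_pow_sections p n X)
  · rw [Category.assoc, relFrobeniusOver_left_comp_snd, twistFst_comp_hom]
    exact absFrobeniusOver_comp_hom p n (frobeniusTwistOver p n X)

/-! ## §3 (ét) A homomorphism that kills one factor of an epimorphic product, the other factor being killed by Frobenius -/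

section Etale

variable {T G G' : SchemeOver k} [GrpObj G] [GrpObj G'] (φ : G ⟶ G')

set_option synthInstance.maxHeartbeats 200000 in
/-- **FROB-KILL, epi form.**  Let `φ : G ⟶ G′` be a `k`-morphism between `k`-group schemes (a homomorphism in the applications;
the proof does not use it) and `a b : T ⟶ G` two `T`-points whose product
`a * b` is an EPIMORPHISM (e.g. `T = G₀ × H ⟶ G` an isomorphism, ★ (o-c3j)).  If `a` is killed by the Frobenius of `G` (`a ≫ F_G = 1`) and `b`
by `φ` (`b ≫ φ = 1`), then `φ ≫ F_{G′} = 1`: indeed `(a*b) ≫ φ ≫ F_{G′} = (a*b) ≫ F_G ≫ φ^{(q)} = ((a ≫ F_G)*(b ≫ F_G)) ≫ φ^{(q)} = (b ≫ F_G) ≫ φ^{(q)}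
= b ≫ φ ≫ F_{G′} = 1` (naturality of `F` twice, `F_G` a homomorphism). [cite: SGA3I, VII_A 4.1] -/
theorem comp_relFrobeniusOver_eq_one_of_epi_mul (a b : T ⟶ G) [Epi (a * b)]
    (ha : a ≫ relFrobeniusOver p n G = 1) (hb : b ≫ φ = 1) : φ ≫ relFrobeniusOver p n G' = 1 := by
  haveI := isMonHom_relFrobeniusOver p n G
  haveI := isMonHom_relFrobeniusOver p n G'
  rw [← cancel_epi (a * b), MonObj.comp_one, ← relFrobeniusOver_comp_map, ← Category.assoc, MonObj.mul_comp, ha, one_mul,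
    Category.assoc, relFrobeniusOver_comp_map, ← Category.assoc, hb, MonObj.one_comp]

set_option synthInstance.maxHeartbeats 200000 in
/-- **FROB-KILL, product form** (the (c3b) engine): `j : G₀ ⟶ G` killed by the Frobenius of `G` (`G₀ ⊆ ker F_G`), `c : H ⟶ G` killed by
`φ` (`H ⊆ ker φ`), and `(j ⊗ c) ≫ μ : G₀ ⊗ H ⟶ G` an EPIMORPHISM (`G = G₀·H`; an isomorphism when `H` is an étale closed subgroup of
complementary rank, ★ `EtaleComplementSplitsUnitComponent`) ⟹ `φ ≫ F_{G′} = 1`.  At an ordinary point: `G = 𝒜_x̄[𝔴]`, `G₀ = ker F ∩ G`, `H` the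
étale line, `φ` = (restriction of) the quotient by `H`; conclusion: the image of `𝒜[𝔴]` in `Ā∕H` dies under Frobenius. [cite: SGA3I, VII_A 4.1] -/
theorem comp_relFrobeniusOver_eq_one_of_epi_tensorHom_mul {G₀ H : SchemeOver k} (j : G₀ ⟶ G) (c : H ⟶ G)
    [Epi ((j ⊗ₘ c) ≫ μ[G])] (hj : j ≫ relFrobeniusOver p n G = 1) (hc : c ≫ φ = 1) :
    φ ≫ relFrobeniusOver p n G' = 1 := by
  have hprod : (fst G₀ H ≫ j) * (snd G₀ H ≫ c) = (j ⊗ₘ c) ≫ μ[G] := by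
    rw [Hom.mul_def, ← lift_map, lift_fst_snd, Category.id_comp]
  haveI : Epi ((fst G₀ H ≫ j) * (snd G₀ H ≫ c)) := by rw [hprod]; infer_instance
  exact comp_relFrobeniusOver_eq_one_of_epi_mul p n φ (fst G₀ H ≫ j) (snd G₀ H ≫ c)
    (by rw [Category.assoc, hj, MonObj.comp_one]) (by rw [Category.assoc, hc, MonObj.comp_one])

end Etale

/-! ## §4 (ss) A homomorphism killing `ker F_G`, when `F` is nilpotent of order two on `G` -/

section Supersingular

variable {G G' : SchemeOver k} [GrpObj G] [GrpObj G'] (φ : G ⟶ G')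

set_option maxHeartbeats 400000 in
set_option synthInstance.maxHeartbeats 400000 in
/-- **FROB-KILL, kernel form** (the (c3c) engine).  Let `φ : G ⟶ G′` be a `k`-morphism between `k`-group schemes which kills the Frobenius
kernel of `G` (`ι_{ker F_G} ≫ φ = 1`), and suppose `F² = 0` on `G` in the form `F_G ≫ F_{G^{(q)}} = 1`.  Then `φ ≫ F_{G′} = 1`.  Proof:
`φ ≫ F_{G′} = F_G ≫ φ^{(q)}` (naturality); `F_{G^{(q)}} = (F_G)^{(q)}` (§2), so `F_G` factors through `ker (F_G)^{(q)} ≅ (ker F_G)^{(q)}` (kernels commute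
with base change, ★ `GroupSchemeKernel.baseChangeIso`), on which `φ^{(q)}` is `(ι ≫ φ)^{(q)} = 1^{(q)} = 1`.  At a supersingular point: `G = 𝒜_x̄[𝔴]`
(one point, rank `q²`, so killed by `F²`, ★ `InfinitesimalKilledByFrobeniusPower`) and `ker F_G = ker F_{Ā}` of rank `q` = the subgroup the
quotient `φ` divides by. [cite: SGA3I, VII_A 4.1] [cite: GortzWedhorn2020, Definition 4.45 (2) (p. 117) and Section (4.7)] -/
theorem comp_relFrobeniusOver_eq_one_of_kerι_comp_eq_one
    (hF : relFrobeniusOver p n G ≫ relFrobeniusOver p n (frobeniusTwistOver p n G) = 1)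
    (hφ : kerι (relFrobeniusOver p n G) ≫ φ = 1) : φ ≫ relFrobeniusOver p n G' = 1 := by
  -- `F² = 0`, read through §2: `F_G ≫ (F_G)^{(q)} = 1`
  rw [relFrobeniusOver_frobeniusTwistOver] at hF
  -- naturality: `φ ≫ F' = F ≫ φ^{(q)}`, and `F = kerLift F hF ≫ ι_{ker F^{(q)}} = kerLift F hF ≫ e.inv ≫ (ι_{ker F})^{(q)}`
  rw [← relFrobeniusOver_comp_map, ← kerLift_ι (relFrobeniusOver p n G) hF,
    ← baseChangeIso_inv_comp_map_kerι (frobSpec k p n) (relFrobeniusOver p n G), Category.assoc, Category.assoc,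
    ← Functor.map_comp, hφ, Functor.map_one, MonObj.comp_one, MonObj.comp_one]

end Supersingular

/-! ## §5 (ED. 2) «`F² = 0`»: the composite form `F_G ≫ F_{G^{(q)}} = 1` ↔ the iterate form `F^{(q²)}_G = 1` -/

section Iterate

/-- Exponent bookkeeping for the absolute Frobenius (`powEndo` only depends on the exponent). [cite: SGA3I, VII_A 4.1] -/
private theorem powEndo_congr {X : Scheme.{u}} {a b : ℕ} (h : a = b) (ha : a ≠ 0) (hb : b ≠ 0)
    (hadda : ∀ (U : X.Opens) (x y : Γ(X, U)), (x + y) ^ a = x ^ a + y ^ a)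
    (haddb : ∀ (U : X.Opens) (x y : Γ(X, U)), (x + y) ^ b = x ^ b + y ^ b) :
    powEndo X a ha hadda = powEndo X b hb haddb := by
  subst h; rfl

/-- `F^{abs}_{pⁿ} ≫ F^{abs}_{pⁿ} = F^{abs}_{p^{2n}}` on any `k`-scheme (`(s^{pⁿ})^{pⁿ} = s^{p^{n+n}}`; ★ `powEndo_comp_powEndo`). [cite: SGA3I, VII_A 4.1] -/
theorem absFrobeniusOver_comp_absFrobeniusOver (X : SchemeOver k) :
    absFrobeniusOver p n X ≫ absFrobeniusOver p n X = absFrobeniusOver p (n + n) X := by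
  rw [powEndo_comp_powEndo (X := X.left) (n := p ^ n) (hn := (expChar_pow_pos k p n).ne')
    (hadd := add_pow_expChar_pow_sections p n X) (p ^ n) (expChar_pow_pos k p n).ne' (add_pow_expChar_pow_sections p n X)
    (fun U a b => by rw [← pow_add]; exact add_pow_expChar_pow_sections p (n + n) X U a b)]
  exact powEndo_congr (pow_add p n n).symm _ _ _ _

variable {T : SchemeOver k} (G : SchemeOver k) [GrpObj G]

set_option synthInstance.maxHeartbeats 200000 in
/-- The trivial `T`-point of `G^{(q)}` projects to `F_T^{abs} ≫ 1_G(T)`: `(1 : T ⟶ G^{(q)}) ≫ pr_G = F^{abs}_T ≫ (1 : T ⟶ G)` (it is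
`(1 : T ⟶ G) ≫ F_{G∕k}`; for abelian varieties ★ `AbelianVariety.one_left_comp_twistFst`). [cite: SGA3I, VII_A 4.1] -/
theorem one_left_comp_twistFst :
    (1 : T ⟶ frobeniusTwistOver p n G).left ≫ twistFst p n G = absFrobeniusOver p n T ≫ (1 : T ⟶ G).left := by
  haveI := isMonHom_relFrobeniusOver p n G
  rw [← MonObj.one_comp (relFrobeniusOver p n G), comp_relFrobeniusOver_left_comp_fst]

set_option maxHeartbeats 800000 in
set_option synthInstance.maxHeartbeats 400000 in
/-- **«`F² = 0`» in two currencies.**  For a `k`-group scheme `G`: the composite `F_{G∕k} ≫ F_{G^{(q)}∕k}` is trivial iff the relative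
`q²`-Frobenius `F^{(n+n)}_{G∕k} : G → G^{(q²)}` is trivial — both say «`F^{abs}_{q²}` of `G` factors through the unit section»
(projections to `G`: `F^{abs}_{pⁿ} ≫ F^{abs}_{pⁿ} = F^{abs}_{p^{2n}}`).  This bridges the iterate currency of ★ `InfinitesimalKilledByFrobeniusPower`
(`relFrobeniusOver p t`, `t = 2f`) to the composite currency of §4. [cite: SGA3I, VII_A 4.1] -/
theorem comp_relFrobeniusOver_frobeniusTwistOver_eq_one_iff :
    relFrobeniusOver p n G ≫ relFrobeniusOver p n (frobeniusTwistOver p n G) = 1 ↔ relFrobeniusOver p (n + n) G = 1 := by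
  -- naturality of the absolute Frobenius across `pr_G : G^{(q)} → G` and across `F_{G∕k} : G → G^{(q)}`
  have hnat : absFrobeniusOver p n (frobeniusTwistOver p n G) ≫ twistFst p n G = twistFst p n G ≫ absFrobeniusOver p n G :=
    powEndo_comp (p ^ n) (expChar_pow_pos k p n).ne' (add_pow_expChar_pow_sections p n (frobeniusTwistOver p n G))
      (twistFst p n G) (add_pow_expChar_pow_sections p n G)
  have hnat2 : absFrobeniusOver p n G ≫ (relFrobeniusOver p n G).left =
      (relFrobeniusOver p n G).left ≫ absFrobeniusOver p n (frobeniusTwistOver p n G) :=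
    powEndo_comp (p ^ n) (expChar_pow_pos k p n).ne' (add_pow_expChar_pow_sections p n G)
      (relFrobeniusOver p n G).left (add_pow_expChar_pow_sections p n (frobeniusTwistOver p n G))
  -- the composite and the trivial point, projected twice down to `G`
  have hFF : (relFrobeniusOver p n G ≫ relFrobeniusOver p n (frobeniusTwistOver p n G)).left ≫
      twistFst p n (frobeniusTwistOver p n G) ≫ twistFst p n G = absFrobeniusOver p (n + n) G := by
    rw [Over.comp_left, Category.assoc, relFrobeniusOver_left_comp_fst_assoc, hnat, relFrobeniusOver_left_comp_fst_assoc,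
      absFrobeniusOver_comp_absFrobeniusOver]
  have h11 : (1 : G ⟶ frobeniusTwistOver p n (frobeniusTwistOver p n G)).left ≫
      twistFst p n (frobeniusTwistOver p n G) ≫ twistFst p n G = absFrobeniusOver p (n + n) G ≫ (1 : G ⟶ G).left := by
    rw [← Category.assoc, one_left_comp_twistFst p n (frobeniusTwistOver p n G), Category.assoc, one_left_comp_twistFst p n G,
      ← Category.assoc, absFrobeniusOver_comp_absFrobeniusOver]
  have hw : (1 : G ⟶ frobeniusTwistOver p n G).left ≫ twistSnd p n G = G.hom := Over.w (1 : G ⟶ frobeniusTwistOver p n G)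
  constructor
  · -- composite trivial ⟹ iterate trivial: compare the projections to `G` at level `n + n`
    intro h
    rw [h] at hFF
    apply frobeniusTwistOver_hom_ext p (n + n)
    rw [relFrobeniusOver_left_comp_fst, one_left_comp_twistFst p (n + n) G]
    exact hFF.symm.trans h11
  · -- iterate trivial ⟹ composite trivial
    intro h
    have hE : absFrobeniusOver p (n + n) G = absFrobeniusOver p (n + n) G ≫ (1 : G ⟶ G).left := by
      have h' : (relFrobeniusOver p (n + n) G).left ≫ twistFst p (n + n) G =
          (1 : G ⟶ frobeniusTwistOver p (n + n) G).left ≫ twistFst p (n + n) G := by rw [h]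
      rwa [relFrobeniusOver_left_comp_fst, one_left_comp_twistFst p (n + n) G] at h'
    apply frobeniusTwistOver_hom_ext p n
    rw [Over.comp_left, Category.assoc, relFrobeniusOver_left_comp_fst, ← hnat2,
      one_left_comp_twistFst p n (frobeniusTwistOver p n G)]
    apply twist_hom_ext p n
    · rw [Category.assoc, relFrobeniusOver_left_comp_fst, absFrobeniusOver_comp_absFrobeniusOver, Category.assoc,
        one_left_comp_twistFst p n G, ← Category.assoc, absFrobeniusOver_comp_absFrobeniusOver]
      exact hE
    · rw [Category.assoc, Category.assoc, relFrobeniusOver_left_comp_snd, hw]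

set_option maxHeartbeats 400000 in
set_option synthInstance.maxHeartbeats 400000 in
/-- **FROB-KILL, kernel form in the ITERATE currency** (the (c3c) engine as ★ `InfinitesimalKilledByFrobeniusPower` delivers it): if the
relative `q²`-Frobenius of `G` is trivial (`relFrobeniusOver p (n+n) G = 1`, e.g. `G` one-point of rank `≤ q²`) and `φ : G ⟶ G′` kills
`ker F_{G∕k}`, then `φ ≫ F_{G′∕k} = 1`. [cite: SGA3I, VII_A 4.1] [cite: GortzWedhorn2020, Definition 4.45 (2) (p. 117) and Section (4.7)] -/
theorem comp_relFrobeniusOver_eq_one_of_relFrobeniusOver_two_eq_one {G' : SchemeOver k} [GrpObj G'] (φ : G ⟶ G')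
    (hF : relFrobeniusOver p (n + n) G = 1) (hφ : kerι (relFrobeniusOver p n G) ≫ φ = 1) :
    φ ≫ relFrobeniusOver p n G' = 1 :=
  comp_relFrobeniusOver_eq_one_of_kerι_comp_eq_one p n φ
    ((comp_relFrobeniusOver_frobeniusTwistOver_eq_one_iff p n G).mpr hF) hφ

end Iterate

end Literature.AlgebraicGeometry.GroupSchemes.FrobKill

end
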